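import Literature.Probability.LatticeModels.InfraredBound
import Literature.Probability.LatticeModels.IsingTransport
import Literature.Probability.LatticeModels.TorusFourierProofs
import Literature.Probability.LatticeModels.RandomCurrentsProofs
import Mathlib.Analysis.SpecialFunctions.Trigonometric.Series
import HarnessLib

/-!
# Gaussian domination and the infrared bound (Friedli–Velenik 2017, Prop. 10.27 ⇒ Thm. 10.24)

Trunk G02 (T-STATMECH), topic `Probability/LatticeModels`; namespaces `Literature.StatMech` (the bond
Dirichlet form of a finite graph, the functional `Z_{G;β}(h)` of Gaussian domination, the edges
and characters of the discrete torus) and `Literature.CritIsing` (one named fact and the main theorem).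
Second layer under the tree's named fact `Literature.Probability.LatticeModels.infraredBound` (crit-ising.S11,
`InfraredBound.lean`; Fröhlich–Simon–Spencer, CMP 50 (1976), Thm. 3.1; Friedli–Velenik 2017,
Thm. 10.24): following

* S. Friedli, Y. Velenik, *Statistical Mechanics of Lattice Systems*, CUP (2017), §10.5.3
  "Gaussian Domination and the Infrared Bound", pp. 503–507,

the infrared bound is **proved from Gaussian domination** (Prop. 10.27, vendored as the named fact
`gaussianDomination`), by the argument printed on pp. 506–507 for `N = 1` (Ising spins):

1. `sum_weight_gradForm_sq_le` — the second-order consequence (10.46)–(10.47) of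
   `Z(λh) ≤ Z(0)`: `β⟨𝓔(σ,h)²⟩ ≤ 𝓔(h,h)` for every real `h`, where
   `𝓔(f,g) = ∑_{{x,y} ∈ E}(f_x - f_y)(g_x - g_y)` (`gradForm`). Instead of differentiating twice we
   use the spin-flip symmetry `σ ↦ -σ` and `cosh x ≥ 1 + x²/2` to get
   `Z(th) ≥ e^{-(β/2)t²𝓔(h,h)}(Z(0) + (β²t²/2)∑_σ w(σ)𝓔(σ,h)²)`, and expand to first order in `t²`.
2. "it also extends to any `h ∈ ℂ^{𝕋_L}` (just treat the real and imaginary parts separately)":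
   applied to `Re χ_k` and `Im χ_k` and added.
3. For the plane wave `h = χ_k` (`torusChar k`), `k ≠ 0`: `𝓔(σ,χ_k) = 2ε(p_k) Ŝ_k(σ)` with
   `Ŝ_k(σ) = ∑_x σ_x χ_k(x)` (`gradFormC_torusChar`; the book's
   `∑_i S_i(-Δα)_i = 2d{1 - (2d)⁻¹∑_{j∼0}cos(p·j)}∑_i S_i e^{ip·i}`, and `2d{…} = 2ε(p)`), and
   `∑_{{x,y}}‖χ_k(x) - χ_k(y)‖² = 2L^d ε(p_k)` (`gradNormSq_torusChar`); both use the
   parametrisation of the torus edges by `(x,i) ↦ {x, x+eᵢ}` (`sum_edgeFinset_torusGraph`, valid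
   for `L ≥ 3`, which is where `L ≠ 2` enters).
4. `⟨|Ŝ_k|²⟩ = L^d Re Ĝ_L(k)` by translation invariance (`sum_weight_norm_spinMode_sq`, via
   `isingTorusTwoPoint_eq_torusTwoPoint`), after identifying torus expectations at zero field with
   `w`-weighted averages, `w(σ) = e^{-(β/2)𝓔(σ,σ)} = e^{-β|E|}e^{β∑σ_xσ_y}`
   (`isingExpect_univ_eq_weight`).

Hence `β · 4ε² · L^d Re Ĝ_L(k) ≤ 2L^d ε`, i.e. `Re Ĝ_L(k) ≤ 1/(2βε(p_k))`, the tree's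
`infraredBound` with its constant (`infraredBound_of_gaussianDomination`).

## Normalisation

The book's `Z_{L;β}(h) = ⟨exp{-β∑_{{i,j}}‖S_i - S_j + h_i - h_j‖²}⟩_{μ₀}` is written for the
Hamiltonian `β∑‖S_i - S_j‖²`, i.e. `-2βS_i·S_j` per bond; the tree's torus measure
`isingTorusMeasure` has `-βσ_xσ_y` per bond. We therefore define
`gaussZ G β h = ∑_σ exp{-(β/2)∑_{{x,y}}(σ_x - σ_y + h_x - h_y)²}` (the book's functional at
`β/2`), so that `gaussZ G β 0 = e^{-β|E|} Z_{G;β}` for the tree's partition function, and the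
resulting bound is `Ĝ_L(p) ≤ 1/(2βε(p))` — the constant of `infraredBound` (the book's
(10.40) `1/(4dβ{1-(2d)⁻¹∑cos})` at `β/2`).

## What remains for `infraredBound_holds`

Only `gaussianDomination` (Friedli–Velenik Prop. 10.27: reflection positivity of the torus
measure through bond-bisecting planes, the Cauchy–Schwarz inequality Lemma 10.28, and the
maximiser/minimal-`N(h)` argument of p. 505).

## Mathlib status

No reflection positivity / Gaussian domination / infrared bound in Mathlib. Anchors:
`Real.hasSum_cosh` (for `cosh x ≥ 1 + x²/2`), `hasDerivAt_iff_tendsto_slope_zero`,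
`SimpleGraph.edgeFinset`, `Sym2.lift`, `ZMod.stdAddChar` (via the tree's `torusChar`),
`Fintype.card_fun`, `ZMod.card`.
-/

noncomputable section

open MeasureTheory Filter Topology Finset Complex
open scoped ComplexConjugate Real

namespace Literature.Probability.LatticeModels

/-! ### The Dirichlet form of a finite graph and the functional `Z_{G;β}(h)` -/

section Graph

variable {V : Type*} [Fintype V] (G : SimpleGraph V) [DecidableRel G.Adj]

/-- The bond bilinear form of a finite graph, `𝓔_G(f,g) = ∑_{{x,y} ∈ E} (f_x - f_y)(g_x - g_y)`
(real functions); `𝓔_G(h,h) = ∑_{{i,j}} (h_i - h_j)²` is the quadratic form of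
Friedli–Velenik 2017, §10.5.3, (10.47), right-hand side, for `ν = 1`. [cite: FriedliVelenik2017, §10.5.3, eq. (10.47)] -/
def gradForm (f g : V → ℝ) : ℝ :=
  ∑ e ∈ G.edgeFinset, Sym2.lift ⟨fun x y => (f x - f y) * (g x - g y), fun x y => by ring⟩ e

/-- The complexified bond form `∑_{{x,y}} (f_x - f_y)(g_x - g_y)` for real `f` and complex `g`
(Friedli–Velenik 2017, proof of Thm. 10.24: "it also extends to any `h ∈ (ℂ^ν)^{𝕋_L}`"). [cite: FriedliVelenik2017, §10.5.3, proof of Thm. 10.24] -/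
def gradFormC (f : V → ℝ) (g : V → ℂ) : ℂ :=
  ∑ e ∈ G.edgeFinset, Sym2.lift ⟨fun x y => ((f x - f y : ℝ) : ℂ) * (g x - g y), fun x y => by
    push_cast; ring⟩ e

/-- The squared bond norm `∑_{{x,y}} ‖g_x - g_y‖²` of a complex function. [cite: FriedliVelenik2017, §10.5.3, proof of Thm. 10.24] -/
def gradNormSq (g : V → ℂ) : ℝ :=
  ∑ e ∈ G.edgeFinset, Sym2.lift ⟨fun x y => ‖g x - g y‖ ^ 2, fun x y => by
    show ‖g x - g y‖ ^ 2 = ‖g y - g x‖ ^ 2; rw [norm_sub_rev]⟩ e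

/-- **The functional `Z_{G;β}(h)` of Gaussian domination** for Ising spins on a finite graph
(Friedli–Velenik 2017, §10.5.3, display before Prop. 10.27, with `ν = 1`, `ρ` = counting
measure on `{±1}`, and `β/2` in place of their `β` so that `Z_{G;β}(0)` is the partition function
of the tree's Hamiltonian `-∑_{{x,y}} σ_xσ_y` up to the constant factor `e^{-β|E|}`):
`Z_{G;β}(h) = ∑_{σ ∈ {±1}^V} exp{-(β/2) ∑_{{x,y} ∈ E} (σ_x - σ_y + h_x - h_y)²}`. [cite: FriedliVelenik2017, §10.5.3, display before Prop. 10.27] -/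
def gaussZ [DecidableEq V] (β : ℝ) (h : V → ℝ) : ℝ :=
  ∑ σ : V → ℤˣ, Real.exp (-(β / 2) *
    gradForm G (fun x => spinAt x σ + h x) (fun x => spinAt x σ + h x))

variable {G}

omit [Fintype V] in
/-- Value of the bond form on an edge `s(x,y)`. [folklore] -/
@[simp] theorem gradForm_term_mk (f g : V → ℝ) (x y : V) :
    Sym2.lift ⟨fun x y => (f x - f y) * (g x - g y), fun x y => by ring⟩ s(x, y) =
      (f x - f y) * (g x - g y) := rfl

/-- The bond form is symmetric. [folklore] -/
theorem gradForm_comm (f g : V → ℝ) : gradForm G f g = gradForm G g f := by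
  unfold gradForm
  refine Finset.sum_congr rfl fun e _ => ?_
  induction e using Sym2.ind with
  | _ x y => simp [mul_comm]

/-- The bond form is additive in the first argument. [folklore] -/
theorem gradForm_add_left (f₁ f₂ g : V → ℝ) :
    gradForm G (f₁ + f₂) g = gradForm G f₁ g + gradForm G f₂ g := by
  unfold gradForm
  rw [← Finset.sum_add_distrib]
  refine Finset.sum_congr rfl fun e _ => ?_
  induction e using Sym2.ind with
  | _ x y => simp only [gradForm_term_mk, Pi.add_apply]; ring

/-- The bond form is homogeneous in the first argument. [folklore] -/
theorem gradForm_smul_left (t : ℝ) (f g : V → ℝ) :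
    gradForm G (t • f) g = t * gradForm G f g := by
  unfold gradForm
  rw [Finset.mul_sum]
  refine Finset.sum_congr rfl fun e _ => ?_
  induction e using Sym2.ind with
  | _ x y => simp only [gradForm_term_mk, Pi.smul_apply, smul_eq_mul]; ring

/-- The bond form is invariant under negating the first argument twice: `𝓔(-f,g) = -𝓔(f,g)`. [folklore] -/
theorem gradForm_neg_left (f g : V → ℝ) : gradForm G (-f) g = -gradForm G f g := by
  rw [show -f = (-1 : ℝ) • f by simp, gradForm_smul_left]; ring

/-- Expansion of the quadratic form: `𝓔(s + t h, s + t h) = 𝓔(s,s) + 2t 𝓔(s,h) + t² 𝓔(h,h)`. [folklore] -/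
theorem gradForm_add_smul_self (s h : V → ℝ) (t : ℝ) :
    gradForm G (s + t • h) (s + t • h) =
      gradForm G s s + 2 * t * gradForm G s h + t ^ 2 * gradForm G h h := by
  have e1 : gradForm G (t • h) s = t * gradForm G h s := gradForm_smul_left t h s
  have e2 : gradForm G s (t • h) = t * gradForm G s h := by
    rw [gradForm_comm, gradForm_smul_left, gradForm_comm]
  have e3 : gradForm G (t • h) (t • h) = t * (t * gradForm G h h) := by
    rw [gradForm_smul_left, gradForm_comm, gradForm_smul_left]
  rw [gradForm_add_left, gradForm_comm s (s + t • h), gradForm_comm (t • h) (s + t • h),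
    gradForm_add_left, gradForm_add_left, e1, e2, e3, gradForm_comm h s]
  ring

/-- The quadratic form is nonnegative. [folklore] -/
theorem gradForm_self_nonneg (f : V → ℝ) : 0 ≤ gradForm G f f := by
  unfold gradForm
  refine Finset.sum_nonneg fun e _ => ?_
  induction e using Sym2.ind with
  | _ x y => simp only [gradForm_term_mk]; nlinarith

/-- Real and imaginary parts of the complexified form. [folklore] -/
theorem gradFormC_re (f : V → ℝ) (g : V → ℂ) :
    (gradFormC G f g).re = gradForm G f (fun x => (g x).re) := by
  unfold gradFormC gradForm
  rw [Complex.re_sum]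
  refine Finset.sum_congr rfl fun e _ => ?_
  induction e using Sym2.ind with
  | _ x y => simp [Complex.mul_re]

/-- Real and imaginary parts of the complexified form. [folklore] -/
theorem gradFormC_im (f : V → ℝ) (g : V → ℂ) :
    (gradFormC G f g).im = gradForm G f (fun x => (g x).im) := by
  unfold gradFormC gradForm
  rw [Complex.im_sum]
  refine Finset.sum_congr rfl fun e _ => ?_
  induction e using Sym2.ind with
  | _ x y => simp [Complex.mul_im]

/-- `∑ ‖g_x - g_y‖² = 𝓔(Re g, Re g) + 𝓔(Im g, Im g)`. [folklore] -/
theorem gradNormSq_eq (g : V → ℂ) :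
    gradNormSq G g = gradForm G (fun x => (g x).re) (fun x => (g x).re) +
      gradForm G (fun x => (g x).im) (fun x => (g x).im) := by
  unfold gradNormSq gradForm
  rw [← Finset.sum_add_distrib]
  refine Finset.sum_congr rfl fun e _ => ?_
  induction e using Sym2.ind with
  | _ x y =>
    simp only [Sym2.lift_mk]
    rw [Complex.sq_norm, Complex.normSq_apply, Complex.sub_re, Complex.sub_im]

/-! ### The Boltzmann weight `w(σ) = e^{-(β/2)𝓔(σ,σ)}` and the spin-flip symmetry -/

omit [Fintype V] in
/-- Negating a configuration negates every spin. [folklore] -/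
theorem spinAt_neg_cfg (σ : V → ℤˣ) (x : V) : spinAt x (-σ) = -spinAt x σ := by
  simp [spinAt, Units.val_neg]

variable [DecidableEq V]

/-- `Z_{G;β}(t h)` expanded around the spin configuration: with `w(σ) = e^{-(β/2)𝓔(σ,σ)}` and
`A_h(σ) = 𝓔(σ,h)`, `Z(th) = e^{-(β/2)t²𝓔(h,h)} ∑_σ w(σ) e^{-βt A_h(σ)}`
(Friedli–Velenik 2017, proof of Thm. 10.24, "elementary computations"). [cite: FriedliVelenik2017, §10.5.3, proof of Thm. 10.24] -/
theorem gaussZ_smul (β t : ℝ) (h : V → ℝ) :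
    gaussZ G β (t • h) = Real.exp (-(β / 2) * t ^ 2 * gradForm G h h) *
      ∑ σ : V → ℤˣ, Real.exp (-(β / 2) * gradForm G (fun x => spinAt x σ) (fun x => spinAt x σ)) *
        Real.exp (-β * t * gradForm G (fun x => spinAt x σ) h) := by
  unfold gaussZ
  rw [Finset.mul_sum]
  refine Finset.sum_congr rfl fun σ _ => ?_
  have hfun : (fun x => spinAt x σ + (t • h) x) = (fun x => spinAt x σ) + t • h := by
    funext x; simp
  rw [hfun, gradForm_add_smul_self, ← Real.exp_add, ← Real.exp_add]
  congr 1
  ring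

/-- Spin-flip symmetry: `∑_σ w(σ) e^{-c A_h(σ)} = ∑_σ w(σ) cosh (c A_h(σ))`, since `w(-σ) = w(σ)`
and `A_h(-σ) = -A_h(σ)`. [folklore] -/
theorem sum_weight_exp_eq_sum_weight_cosh (β c : ℝ) (h : V → ℝ) :
    ∑ σ : V → ℤˣ, Real.exp (-(β / 2) * gradForm G (fun x => spinAt x σ) (fun x => spinAt x σ)) *
        Real.exp (-c * gradForm G (fun x => spinAt x σ) h) =
      ∑ σ : V → ℤˣ, Real.exp (-(β / 2) * gradForm G (fun x => spinAt x σ) (fun x => spinAt x σ)) *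
        Real.cosh (c * gradForm G (fun x => spinAt x σ) h) := by
  set w : (V → ℤˣ) → ℝ := fun σ =>
    Real.exp (-(β / 2) * gradForm G (fun x => spinAt x σ) (fun x => spinAt x σ)) with hw
  set A : (V → ℤˣ) → ℝ := fun σ => gradForm G (fun x => spinAt x σ) h with hA
  have hwneg : ∀ σ, w (-σ) = w σ := fun σ => by
    simp only [hw]
    have : (fun x => spinAt x (-σ)) = -fun x => spinAt x σ := by funext x; simp [spinAt_neg_cfg]
    rw [this, gradForm_neg_left, gradForm_comm, gradForm_neg_left, neg_neg]
  have hAneg : ∀ σ, A (-σ) = -A σ := fun σ => by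
    simp only [hA]
    have : (fun x => spinAt x (-σ)) = -fun x => spinAt x σ := by funext x; simp [spinAt_neg_cfg]
    rw [this, gradForm_neg_left]
  -- reindex by `σ ↦ -σ`
  have hflip : ∑ σ, w σ * Real.exp (-c * A σ) = ∑ σ, w σ * Real.exp (c * A σ) := by
    rw [← Equiv.sum_comp (Equiv.neg (V → ℤˣ)) (fun σ => w σ * Real.exp (-c * A σ))]
    refine Finset.sum_congr rfl fun σ _ => ?_
    simp only [Equiv.neg_apply, hwneg, hAneg]
    ring_nf
  show ∑ σ, w σ * Real.exp (-c * A σ) = ∑ σ, w σ * Real.cosh (c * A σ)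
  have h2 : ∑ σ, w σ * Real.exp (-c * A σ) + ∑ σ, w σ * Real.exp (c * A σ) =
      2 * ∑ σ, w σ * Real.cosh (c * A σ) := by
    rw [Finset.mul_sum, ← Finset.sum_add_distrib]
    refine Finset.sum_congr rfl fun σ _ => ?_
    rw [Real.cosh_eq, neg_mul]
    ring
  linarith

/-- `1 + x²/2 ≤ cosh x` (first two terms of the power series). [folklore] -/
theorem one_add_sq_div_two_le_cosh (x : ℝ) : 1 + x ^ 2 / 2 ≤ Real.cosh x := by
  have h := Real.hasSum_cosh x
  have h2 : ∑ n ∈ Finset.range 2, x ^ (2 * n) / ((2 * n).factorial : ℝ) = 1 + x ^ 2 / 2 := by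
    simp [Finset.sum_range_succ, Nat.factorial]
  rw [← h2]
  exact sum_le_hasSum _ (fun n _ => div_nonneg (by rw [pow_mul]; positivity) (by positivity)) h

/-- **The second-order consequence of Gaussian domination** (Friedli–Velenik 2017, proof of
Thm. 10.24, (10.46)–(10.47)): if `Z_{G;β}(th) ≤ Z_{G;β}(0)` for all real `t` and `β > 0`, then
`β ∑_σ w(σ) 𝓔(σ,h)² ≤ 𝓔(h,h) ∑_σ w(σ)` with `w(σ) = e^{-(β/2)𝓔(σ,σ)}`, i.e.
`⟨𝓔(σ,h)²⟩ ≤ β⁻¹ 𝓔(h,h)` ((10.47) with `β/2` for their `β`). Here derived without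
differentiating twice: `Z(th) ≥ e^{-(β/2)t²𝓔(h,h)}(Z(0) + (β²t²/2) ∑ w 𝓔(σ,h)²)` by the
spin-flip symmetry and `cosh x ≥ 1 + x²/2`, then a first-order expansion in `t²`. [cite: FriedliVelenik2017, §10.5.3, proof of Thm. 10.24, (10.46)–(10.47)] -/
theorem sum_weight_gradForm_sq_le {β : ℝ} (hβ : 0 < β) (h : V → ℝ)
    (hGD : ∀ t : ℝ, gaussZ G β (t • h) ≤ gaussZ G β 0) :
    β * ∑ σ : V → ℤˣ, Real.exp (-(β / 2) * gradForm G (fun x => spinAt x σ) (fun x => spinAt x σ)) *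
        gradForm G (fun x => spinAt x σ) h ^ 2 ≤
      gradForm G h h *
        ∑ σ : V → ℤˣ, Real.exp (-(β / 2) * gradForm G (fun x => spinAt x σ) (fun x => spinAt x σ)) := by
  set w : (V → ℤˣ) → ℝ := fun σ =>
    Real.exp (-(β / 2) * gradForm G (fun x => spinAt x σ) (fun x => spinAt x σ)) with hw
  set A : (V → ℤˣ) → ℝ := fun σ => gradForm G (fun x => spinAt x σ) h with hA
  set B : ℝ := gradForm G h h with hB
  set Z₀ : ℝ := ∑ σ, w σ with hZ₀
  set S : ℝ := ∑ σ, w σ * A σ ^ 2 with hS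
  show β * S ≤ B * Z₀
  have hw_pos : ∀ σ, 0 < w σ := fun σ => Real.exp_pos _
  have hZ₀_pos : 0 < Z₀ := Finset.sum_pos (fun σ _ => hw_pos σ) Finset.univ_nonempty
  have hS0 : 0 ≤ S := Finset.sum_nonneg fun σ _ => mul_nonneg (hw_pos σ).le (sq_nonneg _)
  have hB0 : 0 ≤ B := gradForm_self_nonneg h
  have hZ0 : gaussZ G β 0 = Z₀ := by
    have := gaussZ_smul (G := G) β 0 h
    rw [zero_smul] at this
    rw [this]
    simp [hZ₀, hw]
  -- the lower bound `Z(th) ≥ e^{-(β/2)t²B} (Z₀ + (β² t²/2) S)`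
  have hlow : ∀ t : ℝ, Real.exp (-(β / 2) * t ^ 2 * B) * (Z₀ + β ^ 2 * t ^ 2 / 2 * S) ≤
      gaussZ G β (t • h) := by
    intro t
    rw [gaussZ_smul, show -β * t = -(β * t) by ring, sum_weight_exp_eq_sum_weight_cosh]
    refine mul_le_mul_of_nonneg_left ?_ (Real.exp_pos _).le
    calc Z₀ + β ^ 2 * t ^ 2 / 2 * S = ∑ σ, w σ * (1 + (β * t * A σ) ^ 2 / 2) := by
          rw [hZ₀, hS, Finset.mul_sum, ← Finset.sum_add_distrib]
          refine Finset.sum_congr rfl fun σ _ => ?_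
          ring
      _ ≤ ∑ σ, w σ * Real.cosh (β * t * A σ) :=
          Finset.sum_le_sum fun σ _ =>
            mul_le_mul_of_nonneg_left (one_add_sq_div_two_le_cosh _) (hw_pos σ).le
  -- hence `φ(u) = Z₀ e^{(β/2)Bu} - Z₀ - (β²/2) S u ≥ 0` for `u ≥ 0`
  have hphi : ∀ u : ℝ, 0 ≤ u → Z₀ + β ^ 2 / 2 * S * u ≤ Z₀ * Real.exp (β / 2 * B * u) := by
    intro u hu
    have h1 := (hlow (Real.sqrt u)).trans ((hGD _).trans_eq hZ0)
    rw [Real.sq_sqrt hu] at h1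
    have hexp : Real.exp (-(β / 2) * u * B) * Real.exp (β / 2 * B * u) = 1 := by
      rw [← Real.exp_add]; convert Real.exp_zero using 2; ring
    have h2 := mul_le_mul_of_nonneg_right h1 (Real.exp_pos (β / 2 * B * u)).le
    calc Z₀ + β ^ 2 / 2 * S * u
        = (Z₀ + β ^ 2 * u / 2 * S) * (Real.exp (-(β / 2) * u * B) * Real.exp (β / 2 * B * u)) := by
          rw [hexp]; ring
      _ = Real.exp (-(β / 2) * u * B) * (Z₀ + β ^ 2 * u / 2 * S) * Real.exp (β / 2 * B * u) := by
          ring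
      _ ≤ Z₀ * Real.exp (β / 2 * B * u) := h2
  -- first-order expansion at `u = 0`
  by_contra hcon
  push Not at hcon
  -- the slope of `u ↦ Z₀ e^{cu}` at `0` is `Z₀ c`, `c = (β/2) B`, which is `< (β²/2) S`
  set c : ℝ := β / 2 * B with hc
  have hlt : Z₀ * c < β ^ 2 / 2 * S := by
    rw [hc]; nlinarith
  have hderiv : HasDerivAt (fun u : ℝ => Z₀ * Real.exp (c * u)) (Z₀ * c) 0 := by
    have h1 : HasDerivAt (fun u : ℝ => c * u) c 0 := by
      simpa using (hasDerivAt_id (0 : ℝ)).const_mul c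
    have h2 := (Real.hasDerivAt_exp (c * 0)).comp 0 h1
    simp only [mul_zero, Real.exp_zero, one_mul] at h2
    simpa using h2.const_mul Z₀
  rw [hasDerivAt_iff_tendsto_slope_zero] at hderiv
  have hev : ∀ᶠ u : ℝ in 𝓝[>] 0, u⁻¹ * (Z₀ * Real.exp (c * u) - Z₀) < β ^ 2 / 2 * S := by
    have ht := hderiv.mono_left (nhdsGT_le_nhdsNE 0)
    simp only [zero_add, mul_zero, Real.exp_zero, mul_one, smul_eq_mul] at ht
    exact ht.eventually (gt_mem_nhds hlt)
  obtain ⟨u, hu, hupos⟩ := (hev.and self_mem_nhdsWithin).exists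
  have hupos' : (0 : ℝ) < u := hupos
  have h3 := hphi u hupos'.le
  have h4 : Z₀ * Real.exp (c * u) - Z₀ < β ^ 2 / 2 * S * u := by
    have := (inv_mul_lt_iff₀ hupos').1 hu
    linarith
  rw [hc] at h4
  have : β / 2 * B * u = (β / 2 * B) * u := by ring
  rw [this] at h3
  linarith

end Graph

/-! ### The edges of the discrete torus -/

section TorusEdges

variable {d L : ℕ}

/-- `eᵢ ≠ 0` in `(ℤ/Lℤ)^d` for `L ≥ 2`. [folklore] -/
theorem torus_single_ne_zero (hL : 2 ≤ L) (i : Fin d) : (Pi.single i 1 : TorusSite d L) ≠ 0 := by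
  intro h
  have h1 := congr_fun h i
  simp only [Pi.single_eq_same, Pi.zero_apply] at h1
  have h2 : ((1 : ℕ) : ZMod L) = 0 := by exact_mod_cast h1
  rw [ZMod.natCast_eq_zero_iff] at h2
  exact absurd (Nat.le_of_dvd one_pos h2) (by omega)

/-- `eᵢ + eⱼ ≠ 0` in `(ℤ/Lℤ)^d` for `L ≥ 3`. [folklore] -/
theorem torus_single_add_single_ne_zero (hL : 3 ≤ L) (i j : Fin d) :
    (Pi.single i 1 : TorusSite d L) + Pi.single j 1 ≠ 0 := by
  intro h
  have h1 := congr_fun h i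
  simp only [Pi.add_apply, Pi.single_eq_same, Pi.zero_apply] at h1
  by_cases hij : j = i
  · subst hij
    simp only [Pi.single_eq_same] at h1
    have h2 : ((2 : ℕ) : ZMod L) = 0 := by exact_mod_cast (show (1 : ZMod L) + 1 = 0 from h1)
    rw [ZMod.natCast_eq_zero_iff] at h2
    exact absurd (Nat.le_of_dvd two_pos h2) (by omega)
  · have hne : i ≠ j := fun h => hij h.symm
    simp only [Pi.single_apply, if_neg hne, add_zero] at h1
    have h2 : ((1 : ℕ) : ZMod L) = 0 := by exact_mod_cast h1
    rw [ZMod.natCast_eq_zero_iff] at h2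
    exact absurd (Nat.le_of_dvd one_pos h2) (by omega)

/-- `eᵢ = eⱼ` only for `i = j` (in `(ℤ/Lℤ)^d`, `L ≥ 2`). [folklore] -/
theorem torus_single_injective (hL : 2 ≤ L) {i j : Fin d}
    (h : (Pi.single i 1 : TorusSite d L) = Pi.single j 1) : i = j := by
  by_contra hij
  have h1 := congr_fun h i
  simp only [Pi.single_eq_same, Pi.single_apply, if_neg hij] at h1
  have h2 : ((1 : ℕ) : ZMod L) = 0 := by exact_mod_cast h1
  rw [ZMod.natCast_eq_zero_iff] at h2
  exact absurd (Nat.le_of_dvd one_pos h2) (by omega)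

/-- `x ∼ x + eᵢ` on the discrete torus (`L ≥ 2`). (Friedli–Velenik 2017, §3.1.) [cite: FriedliVelenik2017, §3.1] -/
theorem torusGraph_adj_add_single (hL : 2 ≤ L) (x : TorusSite d L) (i : Fin d) :
    (torusGraph d L).Adj x (x + Pi.single i 1) := by
  rw [torusGraph_adj_iff]
  refine ⟨fun h => torus_single_ne_zero hL i ?_, Or.inl ⟨i, rfl⟩⟩
  have := congr_arg (· - x) h
  simpa using this.symm

/-- **The edges of the discrete torus, each counted once**: for `L ≥ 3` the map
`(x, i) ↦ {x, x + eᵢ}` is a bijection from `(ℤ/Lℤ)^d × {1,…,d}` onto the edge set of the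
nearest-neighbour torus graph, so that `∑_{e ∈ E} F(e) = ∑_x ∑ᵢ F({x, x + eᵢ})`
(Friedli–Velenik 2017, §10.5.3, the sums "`∑_{{i,j} ∈ 𝓔_L}`"). [cite: FriedliVelenik2017, §10.5.3] -/
theorem sum_edgeFinset_torusGraph [NeZero L] {α : Type*} [AddCommMonoid α] (hL : 3 ≤ L)
    (F : Sym2 (TorusSite d L) → α) :
    ∑ e ∈ (torusGraph d L).edgeFinset, F e =
      ∑ x : TorusSite d L, ∑ i : Fin d, F s(x, x + Pi.single i 1) := by
  classical
  have hL2 : 2 ≤ L := by omega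
  set φ : TorusSite d L × Fin d → Sym2 (TorusSite d L) := fun p => s(p.1, p.1 + Pi.single p.2 1)
    with hφ
  have hinj : Set.InjOn φ (univ : Finset (TorusSite d L × Fin d)) := by
    rintro ⟨x, i⟩ - ⟨y, j⟩ - h
    simp only [hφ, Sym2.eq_iff] at h
    rcases h with ⟨rfl, h2⟩ | ⟨h1, h2⟩
    · exact Prod.ext rfl (torus_single_injective hL2 (add_left_cancel h2))
    · exfalso
      have : (Pi.single i 1 : TorusSite d L) + Pi.single j 1 = 0 := by
        have h3 : x + Pi.single i 1 + Pi.single j 1 = x := by rw [h2, ← h1]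
        have h4 := congr_arg (· - x) h3
        simpa [add_assoc] using h4
      exact torus_single_add_single_ne_zero hL i j this
  have himage : (univ : Finset (TorusSite d L × Fin d)).image φ = (torusGraph d L).edgeFinset := by
    ext e
    simp only [Finset.mem_image, Finset.mem_univ, true_and, SimpleGraph.mem_edgeFinset]
    constructor
    · rintro ⟨⟨x, i⟩, rfl⟩
      exact (SimpleGraph.mem_edgeSet _).2 (torusGraph_adj_add_single hL2 x i)
    · intro he
      induction e using Sym2.ind with
      | _ a b =>
        have hadj := (SimpleGraph.mem_edgeSet _).1 he
        rcases (torusGraph_adj_iff a b).1 hadj with ⟨-, ⟨i, rfl⟩ | ⟨i, rfl⟩⟩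
        · exact ⟨(a, i), rfl⟩
        · exact ⟨(b, i), Sym2.eq_swap⟩
  rw [← himage, Finset.sum_image hinj, ← Finset.univ_product_univ, Finset.sum_product]

end TorusEdges

/-! ### Characters along the torus edges -/

section TorusChar

variable {d L : ℕ} [NeZero L]

/-- `χ_k(eᵢ) = e^{i pᵢ}` with `p = 2πk/L` the lattice momentum (`L ≥ 2`). [folklore] -/
theorem torusChar_single (hL : 2 ≤ L) (k : TorusSite d L) (i : Fin d) :
    torusChar k (Pi.single i 1) = Complex.exp (latticeMomentum L k i * I) := by
  unfold torusChar
  rw [Finset.prod_eq_single i (fun j _ hj => by rw [Pi.single_eq_of_ne hj, mul_zero, AddChar.map_zero_eq_one])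
    (fun h => absurd (Finset.mem_univ i) h), Pi.single_eq_same, stdAddChar_mul_eq_exp]
  congr 1
  have h1 : (1 : ZMod L).val = 1 := ZMod.val_one'' (by omega)
  rw [h1, mul_one]
  unfold latticeMomentum
  push_cast
  ring

/-- `‖1 - e^{iθ}‖² = 2(1 - cos θ)`. [folklore] -/
theorem normSq_one_sub_exp_mul_I (θ : ℝ) :
    Complex.normSq (1 - Complex.exp (θ * I)) = 2 * (1 - Real.cos θ) := by
  rw [Complex.normSq_apply, Complex.sub_re, Complex.sub_im, Complex.one_re, Complex.one_im,
    Complex.exp_ofReal_mul_I_re, Complex.exp_ofReal_mul_I_im]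
  nlinarith [Real.sin_sq_add_cos_sq θ]

/-- `(1 - u)(1 - conj u) = 2(1 - cos θ)` for `u = e^{iθ}`. [folklore] -/
theorem one_sub_mul_one_sub_conj_exp (θ : ℝ) :
    (1 - Complex.exp (θ * I)) * (1 - conj (Complex.exp (θ * I))) = ((2 * (1 - Real.cos θ) : ℝ) : ℂ) := by
  rw [← normSq_one_sub_exp_mul_I, ← Complex.mul_conj, map_sub, map_one]

/-- The spin Fourier mode `Ŝ_k(σ) = ∑_x σ_x χ_k(x)` (Friedli–Velenik 2017, proof of Thm. 10.24,
`∑_i S_i e^{ip·i}`). [cite: FriedliVelenik2017, §10.5.3, proof of Thm. 10.24] -/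
def spinMode (k : TorusSite d L) (σ : SpinConfig (TorusSite d L)) : ℂ :=
  ∑ x, (spinAt x σ : ℂ) * torusChar k x

/-- **`𝓔(σ, χ_k) = 2ε(p_k) Ŝ_k(σ)`**: the bond form of a spin configuration against a plane wave
is the dispersion times the spin Fourier mode (Friedli–Velenik 2017, proof of Thm. 10.24:
`∑_{{i,j}} (S_i - S_j)(h_i - h_j) = ∑_i S_i (-Δα)_i = 2d{1 - (2d)⁻¹∑_{j∼0} cos(p·j)} ∑_i S_i e^{ip·i}`;
here `2d{…} = 2ε(p)`), for `L ≥ 3`. [cite: FriedliVelenik2017, §10.5.3, proof of Thm. 10.24] -/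
theorem gradFormC_torusChar (hL : 3 ≤ L) (k : TorusSite d L) (σ : SpinConfig (TorusSite d L)) :
    gradFormC (torusGraph d L) (fun x => spinAt x σ) (torusChar k) =
      ((2 * dispersion (latticeMomentum L k) : ℝ) : ℂ) * spinMode k σ := by
  classical
  have hL2 : 2 ≤ L := by omega
  unfold gradFormC
  rw [sum_edgeFinset_torusGraph hL]
  simp only [Sym2.lift_mk]
  -- `χ(x + eᵢ) = χ(x) uᵢ`
  set u : Fin d → ℂ := fun i => Complex.exp (latticeMomentum L k i * I) with hu
  have hχ : ∀ x i, torusChar k (x + Pi.single i 1) = torusChar k x * u i := fun x i => by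
    rw [torusChar_add_right, torusChar_single hL2]
  -- the shifted mode `∑_x σ_{x+eᵢ} χ(x) = conj uᵢ · Ŝ`
  have hshift : ∀ i, ∑ x, (spinAt (x + Pi.single i 1) σ : ℂ) * torusChar k x =
      conj (u i) * spinMode k σ := by
    intro i
    rw [spinMode, Finset.mul_sum,
      ← Equiv.sum_comp (Equiv.addRight (Pi.single i 1)) (fun x => conj (u i) * ((spinAt x σ : ℂ) * torusChar k x))]
    refine Finset.sum_congr rfl fun x _ => ?_
    simp only [Equiv.coe_addRight, hχ]
    have hu1 : conj (u i) * u i = 1 := by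
      rw [mul_comm, Complex.mul_conj, hu]
      simp [Complex.normSq_eq_norm_sq, Complex.norm_exp_ofReal_mul_I]
    calc (spinAt (x + Pi.single i 1) σ : ℂ) * torusChar k x
        = (spinAt (x + Pi.single i 1) σ : ℂ) * torusChar k x * (conj (u i) * u i) := by rw [hu1, mul_one]
      _ = conj (u i) * ((spinAt (x + Pi.single i 1) σ : ℂ) * (torusChar k x * u i)) := by ring
  -- expand
  have hterm : ∀ x i, (((spinAt x σ - spinAt (x + Pi.single i 1) σ : ℝ)) : ℂ) *
      (torusChar k x - torusChar k (x + Pi.single i 1)) =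
        (1 - u i) * ((spinAt x σ : ℂ) * torusChar k x) -
          (1 - u i) * ((spinAt (x + Pi.single i 1) σ : ℂ) * torusChar k x) := by
    intro x i; rw [hχ]; push_cast; ring
  have hi : ∀ i, ∑ x, (((spinAt x σ - spinAt (x + Pi.single i 1) σ : ℝ)) : ℂ) *
      (torusChar k x - torusChar k (x + Pi.single i 1)) =
        (1 - u i) * (1 - conj (u i)) * spinMode k σ := by
    intro i
    calc ∑ x, (((spinAt x σ - spinAt (x + Pi.single i 1) σ : ℝ)) : ℂ) *
          (torusChar k x - torusChar k (x + Pi.single i 1))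
        = ∑ x, ((1 - u i) * ((spinAt x σ : ℂ) * torusChar k x) -
            (1 - u i) * ((spinAt (x + Pi.single i 1) σ : ℂ) * torusChar k x)) :=
          Finset.sum_congr rfl fun x _ => hterm x i
      _ = (1 - u i) * ∑ x, (spinAt x σ : ℂ) * torusChar k x -
            (1 - u i) * ∑ x, (spinAt (x + Pi.single i 1) σ : ℂ) * torusChar k x := by
          rw [Finset.sum_sub_distrib, Finset.mul_sum, Finset.mul_sum]
      _ = (1 - u i) * spinMode k σ - (1 - u i) * (conj (u i) * spinMode k σ) := by
          rw [hshift]; rfl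
      _ = (1 - u i) * (1 - conj (u i)) * spinMode k σ := by ring
  have hsum : ∑ i, (1 - u i) * (1 - conj (u i)) =
      ((2 * dispersion (latticeMomentum L k) : ℝ) : ℂ) := by
    unfold dispersion
    push_cast
    rw [Finset.mul_sum]
    refine Finset.sum_congr rfl fun i _ => ?_
    have := one_sub_mul_one_sub_conj_exp (latticeMomentum L k i)
    rw [hu]
    push_cast at this ⊢
    exact this
  rw [Finset.sum_comm]
  calc ∑ i, ∑ x, (((spinAt x σ - spinAt (x + Pi.single i 1) σ : ℝ)) : ℂ) *
        (torusChar k x - torusChar k (x + Pi.single i 1))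
      = ∑ i, (1 - u i) * (1 - conj (u i)) * spinMode k σ := Finset.sum_congr rfl fun i _ => hi i
    _ = (∑ i, (1 - u i) * (1 - conj (u i))) * spinMode k σ := by rw [Finset.sum_mul]
    _ = ((2 * dispersion (latticeMomentum L k) : ℝ) : ℂ) * spinMode k σ := by rw [hsum]

/-- **`∑_{{x,y}} ‖χ_k(x) - χ_k(y)‖² = 2 L^d ε(p_k)`** (Friedli–Velenik 2017, proof of Thm. 10.24:
`∑_{{i,j}} ‖h_i - h_j‖² = ∑_i ᾱ_i(-Δα)_i = 2d|𝕋_L|{1 - (2d)⁻¹∑_{j∼0} cos(p·j)}`), for `L ≥ 3`. [cite: FriedliVelenik2017, §10.5.3, proof of Thm. 10.24] -/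
theorem gradNormSq_torusChar (hL : 3 ≤ L) (k : TorusSite d L) :
    gradNormSq (torusGraph d L) (torusChar k) =
      2 * (L : ℝ) ^ d * dispersion (latticeMomentum L k) := by
  classical
  have hL2 : 2 ≤ L := by omega
  unfold gradNormSq
  rw [sum_edgeFinset_torusGraph hL]
  simp only [Sym2.lift_mk]
  have hterm : ∀ (x : TorusSite d L) (i : Fin d),
      ‖torusChar k x - torusChar k (x + Pi.single i 1)‖ ^ 2 =
        2 * (1 - Real.cos (latticeMomentum L k i)) := by
    intro x i
    rw [torusChar_add_right, torusChar_single hL2, ← mul_one_sub, norm_mul, norm_torusChar,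
      one_mul, ← Complex.normSq_eq_norm_sq, normSq_one_sub_exp_mul_I]
  simp_rw [hterm]
  rw [Finset.sum_const, Finset.card_univ, nsmul_eq_mul, Fintype.card_fun, ZMod.card,
    Fintype.card_fin]
  unfold dispersion
  rw [Finset.mul_sum, Finset.mul_sum]
  push_cast
  refine Finset.sum_congr rfl fun i _ => ?_
  ring

end TorusChar

/-! ### Zero-field expectations on the whole graph as `w`-weighted averages -/

section Bridge

variable {V : Type*} [Fintype V] [DecidableEq V] (G : SimpleGraph V) [DecidableRel G.Adj]

/-- Configurations of the whole (finite) vertex set versus finite configurations on `univ`. [folklore] -/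
def cfgUniv : (V → ℤˣ) ≃ (↥(univ : Finset V) → ℤˣ) where
  toFun σ := fun x => σ x
  invFun τ := fun x => τ ⟨x, mem_univ x⟩
  left_inv _ := rfl
  right_inv _ := rfl

omit [DecidableEq V] in
/-- Gluing a configuration of `univ` gives it back. [folklore] -/
@[simp] theorem glue_univ_cfgUniv (σ : V → ℤˣ) : glue univ (cfgUniv σ) .free = σ := by
  funext x
  rw [glue_apply_of_mem _ _ _ (mem_univ x)]
  rfl

variable {G} in
omit [DecidableEq V] in
/-- `𝓔(σ,σ) = 2|E| - 2 ∑_{e} σ_xσ_y` for a spin configuration (`σ_x² = 1`). [folklore] -/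
theorem gradForm_spin_self (σ : V → ℤˣ) :
    gradForm G (fun x => spinAt x σ) (fun x => spinAt x σ) =
      2 * #G.edgeFinset - 2 * ∑ e ∈ G.edgeFinset, bondSpin σ e := by
  unfold gradForm
  rw [Finset.mul_sum, Finset.card_eq_sum_ones, Nat.cast_sum, Finset.mul_sum, ← Finset.sum_sub_distrib]
  refine Finset.sum_congr rfl fun e _ => ?_
  induction e using Sym2.ind with
  | _ x y =>
    simp only [gradForm_term_mk, bondSpin_mk, Nat.cast_one, mul_one]
    nlinarith [spinAt_sq x σ, spinAt_sq y σ]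

/-- The zero-field free Boltzmann weight on the whole graph is `e^{β|E|} w(σ)`,
`w(σ) = e^{-(β/2)𝓔(σ,σ)}` (`-σ_xσ_y = ½(σ_x - σ_y)² - 1`; the normalisation remark in the
docstring of `InfraredBound.lean`). [folklore] -/
theorem isingWeight_univ_cfgUniv (β : ℝ) (σ : V → ℤˣ) :
    isingWeight G univ β 0 .free (cfgUniv σ) =
      Real.exp (β * #G.edgeFinset) *
        Real.exp (-(β / 2) * gradForm G (fun x => spinAt x σ) (fun x => spinAt x σ)) := by
  rw [isingWeight_univ_free_eq, glue_univ_cfgUniv, ← Real.exp_sum, ← Real.exp_add,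
    Finset.sum_coe_sort _ (fun e => β * bondSpin σ e), gradForm_spin_self, ← Finset.mul_sum]
  congr 1
  ring

/-- **Zero-field expectations on the whole graph as `w`-weighted averages**:
`⟨F⟩_{V;β,0} = ∑_σ w(σ)F(σ) / ∑_σ w(σ)` with `w(σ) = e^{-(β/2)𝓔(σ,σ)}` (the constant `e^{β|E|}`
cancels; Friedli–Velenik 2017, §3.1, eq. (3.8) and §10.5.3). [cite: FriedliVelenik2017, §3.1, eq. (3.8)] -/
theorem isingExpect_univ_eq_weight (β : ℝ) {F : SpinConfig V → ℝ} (hF : Measurable F) :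
    isingExpect G univ β 0 .free F =
      (∑ σ : V → ℤˣ, Real.exp (-(β / 2) * gradForm G (fun x => spinAt x σ) (fun x => spinAt x σ)) *
          F σ) /
        ∑ σ : V → ℤˣ, Real.exp (-(β / 2) * gradForm G (fun x => spinAt x σ) (fun x => spinAt x σ)) := by
  rw [isingExpect, integral_isingMeasure G univ β 0 .free hF, isingPartitionFunction,
    ← Equiv.sum_comp (cfgUniv (V := V)) (fun τ => isingWeight G univ β 0 .free τ * F (glue univ τ .free)),
    ← Equiv.sum_comp (cfgUniv (V := V)) (fun τ => isingWeight G univ β 0 .free τ)]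
  simp only [isingWeight_univ_cfgUniv, glue_univ_cfgUniv]
  rw [show ∑ σ : V → ℤˣ, Real.exp (β * #G.edgeFinset) *
      Real.exp (-(β / 2) * gradForm G (fun x => spinAt x σ) (fun x => spinAt x σ)) * F σ =
      Real.exp (β * #G.edgeFinset) * ∑ σ : V → ℤˣ,
        Real.exp (-(β / 2) * gradForm G (fun x => spinAt x σ) (fun x => spinAt x σ)) * F σ by
      rw [Finset.mul_sum]; exact Finset.sum_congr rfl fun σ _ => by ring,
    ← Finset.mul_sum, mul_div_mul_left _ _ (Real.exp_pos _).ne']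

end Bridge

end Literature.Probability.LatticeModels

/-! ### Gaussian domination (named fact) and the infrared bound -/

namespace Literature.Probability.LatticeModels

open Percolation

variable {d L : ℕ} [NeZero L]

/-- **Gaussian domination** (Friedli–Velenik 2017, Prop. 10.27, eq. (10.43):
"For all `h = (h_i)_{i ∈ 𝕋_L}`, `Z_{L;β}(h) ≤ Z_{L;β}(0)`", proved there from reflection positivity
through the planes bisecting bonds, Lemma 10.28; originally Fröhlich–Simon–Spencer, CMP 50 (1976),
§3). For the nearest-neighbour Ising model (`ν = 1`) on the torus `(ℤ/Lℤ)^d`, `L` even, `L ≠ 2`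
(the tree's simple torus graph of side `2` is not the periodic torus, cf. `infraredBound`),
`β ≥ 0` and every real `h`:
`∑_σ exp{-(β/2)∑_{{x,y}}(σ_x - σ_y + h_x - h_y)²} ≤ ∑_σ exp{-(β/2)∑_{{x,y}}(σ_x - σ_y)²}`
(`gaussZ`, the book's `Z_{L;β}(h)` with `β/2` for its `β`). [cite: FriedliVelenik2017, Prop. 10.27, eq. (10.43)] -/
def gaussianDomination : Prop :=
  Even L → L ≠ 2 → ∀ ⦃β : ℝ⦄, 0 ≤ β → ∀ h : TorusSite d L → ℝ,
    gaussZ (torusGraph d L) β h ≤ gaussZ (torusGraph d L) β 0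

/-- `∑_σ w(σ) ‖Ŝ_k(σ)‖² = (∑_σ w(σ)) · L^d Re Ĝ_L(k)`: the `w`-average of the squared spin mode
is `L^d` times the Fourier transform of the two-point function (translation invariance,
`isingTorusTwoPoint_eq_torusTwoPoint`; Friedli–Velenik 2017, proof of Thm. 10.24, last display:
`⟨|∑_i S_i e^{ip·i}|²⟩ = |𝕋_L| ∑_j e^{ip·j}⟨S_0S_j⟩`). [cite: FriedliVelenik2017, §10.5.3, proof of Thm. 10.24] -/
theorem sum_weight_norm_spinMode_sq (β : ℝ) (k : TorusSite d L) :
    ∑ σ : SpinConfig (TorusSite d L),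
        Real.exp (-(β / 2) * gradForm (torusGraph d L) (fun x => spinAt x σ) (fun x => spinAt x σ)) *
          ‖spinMode k σ‖ ^ 2 =
      (∑ σ : SpinConfig (TorusSite d L),
          Real.exp (-(β / 2) * gradForm (torusGraph d L) (fun x => spinAt x σ) (fun x => spinAt x σ))) *
        ((L : ℝ) ^ d * (twoPointFourierTorus (isingTorusMeasure d L β 0) k).re) := by
  classical
  set w : SpinConfig (TorusSite d L) → ℝ := fun σ =>
    Real.exp (-(β / 2) * gradForm (torusGraph d L) (fun x => spinAt x σ) (fun x => spinAt x σ)) with hw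
  set W : ℝ := ∑ σ, w σ with hW
  have hWpos : 0 < W := Finset.sum_pos (fun σ _ => Real.exp_pos _) Finset.univ_nonempty
  -- `‖Ŝ‖² = ∑_{x,y} σ_xσ_y Re(χ_x conj χ_y)`
  have hnorm : ∀ σ, ‖spinMode k σ‖ ^ 2 =
      ∑ x, ∑ y, spinPair x y σ * (torusChar k x * conj (torusChar k y)).re := by
    intro σ
    have h0 : ‖spinMode k σ‖ ^ 2 = (spinMode k σ * conj (spinMode k σ)).re := by
      rw [Complex.mul_conj, Complex.ofReal_re, Complex.normSq_eq_norm_sq]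
    rw [h0, spinMode, map_sum, Finset.sum_mul_sum, Complex.re_sum]
    refine Finset.sum_congr rfl fun x _ => ?_
    rw [Complex.re_sum]
    refine Finset.sum_congr rfl fun y _ => ?_
    rw [map_mul, Complex.conj_ofReal]
    have : (spinAt x σ : ℂ) * torusChar k x * ((spinAt y σ : ℂ) * conj (torusChar k y)) =
        ((spinAt x σ * spinAt y σ : ℝ) : ℂ) * (torusChar k x * conj (torusChar k y)) := by
      push_cast; ring
    rw [this, Complex.re_ofReal_mul]
    rfl
  -- `∑_σ w σ_xσ_y = W · G(x,y)`
  have hpair : ∀ x y, ∑ σ, w σ * spinPair x y σ = W * isingTorusTwoPoint d L β 0 x y := by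
    intro x y
    have h := isingExpect_univ_eq_weight (torusGraph d L) β (measurable_spinPair x y)
    rw [← hw] at h
    have h' : isingTorusTwoPoint d L β 0 x y = (∑ σ, w σ * spinPair x y σ) / W := h
    rw [h', mul_div_cancel₀ _ hWpos.ne']
  -- `∑_{x,y} χ_x conj χ_y G(y - x) = L^d Ĝ(k)`
  have hfourier : ∑ x : TorusSite d L, ∑ y, (isingTorusTwoPoint d L β 0 x y : ℂ) *
      (torusChar k x * conj (torusChar k y)) =
        ((L : ℂ) ^ d) * twoPointFourierTorus (isingTorusMeasure d L β 0) k := by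
    have hrow : ∀ x : TorusSite d L, ∑ y, (isingTorusTwoPoint d L β 0 x y : ℂ) *
        (torusChar k x * conj (torusChar k y)) =
          twoPointFourierTorus (isingTorusMeasure d L β 0) k := by
      intro x
      rw [twoPointFourierTorus, torusFourier_eq_sum_torusChar,
        ← Equiv.sum_comp (Equiv.addLeft x)]
      refine Finset.sum_congr rfl fun z _ => ?_
      simp only [Equiv.coe_addLeft, isingTorusTwoPoint_eq_torusTwoPoint, add_sub_cancel_left,
        torusChar_add_right, map_mul]
      have h1 : torusChar k x * conj (torusChar k x) = 1 := torusChar_mul_conj k x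
      calc (torusTwoPoint (isingTorusMeasure d L β 0) z : ℂ) *
            (torusChar k x * (conj (torusChar k x) * conj (torusChar k z)))
          = (torusTwoPoint (isingTorusMeasure d L β 0) z : ℂ) * conj (torusChar k z) *
              (torusChar k x * conj (torusChar k x)) := by ring
        _ = (torusTwoPoint (isingTorusMeasure d L β 0) z : ℂ) * conj (torusChar k z) := by
            rw [h1, mul_one]
    simp_rw [hrow]
    rw [Finset.sum_const, Finset.card_univ, nsmul_eq_mul, Fintype.card_fun, ZMod.card,
      Fintype.card_fin]
    push_cast
    ring
  -- assemble
  calc ∑ σ, w σ * ‖spinMode k σ‖ ^ 2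
      = ∑ σ, ∑ x, ∑ y, w σ * spinPair x y σ * (torusChar k x * conj (torusChar k y)).re := by
        refine Finset.sum_congr rfl fun σ _ => ?_
        rw [hnorm, Finset.mul_sum]
        refine Finset.sum_congr rfl fun x _ => ?_
        rw [Finset.mul_sum]
        refine Finset.sum_congr rfl fun y _ => ?_
        ring
    _ = ∑ x, ∑ y, (∑ σ, w σ * spinPair x y σ) * (torusChar k x * conj (torusChar k y)).re := by
        rw [Finset.sum_comm]
        refine Finset.sum_congr rfl fun x _ => ?_
        rw [Finset.sum_comm]
        refine Finset.sum_congr rfl fun y _ => ?_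
        rw [Finset.sum_mul]
    _ = W * (∑ x, ∑ y, (isingTorusTwoPoint d L β 0 x y : ℂ) *
          (torusChar k x * conj (torusChar k y))).re := by
        rw [Complex.re_sum, Finset.mul_sum]
        refine Finset.sum_congr rfl fun x _ => ?_
        rw [Complex.re_sum, Finset.mul_sum]
        refine Finset.sum_congr rfl fun y _ => ?_
        rw [hpair, Complex.re_ofReal_mul]
        ring
    _ = W * ((L : ℝ) ^ d * (twoPointFourierTorus (isingTorusMeasure d L β 0) k).re) := by
        rw [hfourier]
        congr 1
        rw [show ((L : ℂ) ^ d) = (((L : ℝ) ^ d : ℝ) : ℂ) by push_cast; rfl, Complex.re_ofReal_mul]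

/-- **The infrared bound from Gaussian domination** (Friedli–Velenik 2017, Thm. 10.24 from
Prop. 10.27, proof on pp. 506–507, specialised to `N = 1`): granting `gaussianDomination`, the
tree's named fact `infraredBound` — `Re Ĝ_L(k) ≤ 1/(2β ε(p_k))` for `L` even, `L ≠ 2`, `β > 0`,
`k ≠ 0` — follows: the second-order expansion gives `β⟨𝓔(σ,h)²⟩ ≤ 𝓔(h,h)` for real `h`
(`sum_weight_gradForm_sq_le`), hence for complex `h` (real and imaginary parts); for the plane
wave `h = χ_k`, `𝓔(σ,χ_k) = 2ε(p_k)Ŝ_k(σ)` and `∑‖χ_k(x)-χ_k(y)‖² = 2L^dε(p_k)`, and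
`⟨|Ŝ_k|²⟩ = L^d Re Ĝ_L(k)` by translation invariance. [cite: FriedliVelenik2017, Thm. 10.24, proof pp. 506–507] -/
theorem infraredBound_of_gaussianDomination (hGD : gaussianDomination (d := d) (L := L)) :
    infraredBound (d := d) (L := L) := by
  intro hL hL2 β hβ k hk
  classical
  have hL0 : L ≠ 0 := NeZero.ne L
  have hL3 : 3 ≤ L := by
    obtain ⟨m, hm⟩ := hL
    omega
  set ε : ℝ := dispersion (latticeMomentum L k) with hε
  have hεpos : 0 < ε :=
    lt_of_le_of_ne (dispersion_nonneg _)
      (fun h => hk ((dispersion_latticeMomentum_eq_zero_iff_holds k).1 h.symm))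
  -- the two real test functions and the second-order inequalities
  set h₁ : TorusSite d L → ℝ := fun x => (torusChar k x).re with hh₁
  set h₂ : TorusSite d L → ℝ := fun x => (torusChar k x).im with hh₂
  have key₁ := sum_weight_gradForm_sq_le (G := torusGraph d L) hβ h₁ fun t => hGD hL hL2 hβ.le _
  have key₂ := sum_weight_gradForm_sq_le (G := torusGraph d L) hβ h₂ fun t => hGD hL hL2 hβ.le _
  set w : SpinConfig (TorusSite d L) → ℝ := fun σ =>
    Real.exp (-(β / 2) * gradForm (torusGraph d L) (fun x => spinAt x σ) (fun x => spinAt x σ))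
    with hw
  set W : ℝ := ∑ σ, w σ with hW
  have hWpos : 0 < W := Finset.sum_pos (fun σ _ => Real.exp_pos _) Finset.univ_nonempty
  -- `A₁² + A₂² = 4ε²‖Ŝ‖²`
  have hA : ∀ σ : SpinConfig (TorusSite d L),
      gradForm (torusGraph d L) (fun x => spinAt x σ) h₁ ^ 2 +
        gradForm (torusGraph d L) (fun x => spinAt x σ) h₂ ^ 2 =
          4 * ε ^ 2 * ‖spinMode k σ‖ ^ 2 := by
    intro σ
    have hC := gradFormC_torusChar hL3 k σ
    have hre : gradForm (torusGraph d L) (fun x => spinAt x σ) h₁ = 2 * ε * (spinMode k σ).re := by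
      rw [hh₁, ← gradFormC_re, hC, Complex.re_ofReal_mul]
    have him : gradForm (torusGraph d L) (fun x => spinAt x σ) h₂ = 2 * ε * (spinMode k σ).im := by
      rw [hh₂, ← gradFormC_im, hC, Complex.im_ofReal_mul]
    rw [hre, him, ← Complex.normSq_eq_norm_sq, Complex.normSq_apply]
    ring
  -- `B₁ + B₂ = 2L^dε`
  have hB : gradForm (torusGraph d L) h₁ h₁ + gradForm (torusGraph d L) h₂ h₂ =
      2 * (L : ℝ) ^ d * ε := by
    rw [hh₁, hh₂, ← gradNormSq_eq, gradNormSq_torusChar hL3]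
  -- add the two inequalities
  have hS : ∑ σ, w σ * gradForm (torusGraph d L) (fun x => spinAt x σ) h₁ ^ 2 +
      ∑ σ, w σ * gradForm (torusGraph d L) (fun x => spinAt x σ) h₂ ^ 2 =
        4 * ε ^ 2 * ∑ σ, w σ * ‖spinMode k σ‖ ^ 2 := by
    rw [← Finset.sum_add_distrib, Finset.mul_sum]
    refine Finset.sum_congr rfl fun σ _ => ?_
    rw [← mul_add, hA σ]
    ring
  have hsum : β * (4 * ε ^ 2 * ∑ σ, w σ * ‖spinMode k σ‖ ^ 2) ≤ 2 * (L : ℝ) ^ d * ε * W := by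
    calc β * (4 * ε ^ 2 * ∑ σ, w σ * ‖spinMode k σ‖ ^ 2)
        = β * ∑ σ, w σ * gradForm (torusGraph d L) (fun x => spinAt x σ) h₁ ^ 2 +
            β * ∑ σ, w σ * gradForm (torusGraph d L) (fun x => spinAt x σ) h₂ ^ 2 := by
          rw [← hS, mul_add]
      _ ≤ gradForm (torusGraph d L) h₁ h₁ * W + gradForm (torusGraph d L) h₂ h₂ * W :=
          add_le_add key₁ key₂
      _ = 2 * (L : ℝ) ^ d * ε * W := by rw [← add_mul, hB]
  rw [sum_weight_norm_spinMode_sq β k] at hsum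
  -- divide by `2 L^d ε W > 0`
  have hLd : (0 : ℝ) < (L : ℝ) ^ d := by
    have : (0 : ℝ) < L := Nat.cast_pos.2 (Nat.pos_of_ne_zero hL0)
    positivity
  set R := (twoPointFourierTorus (isingTorusMeasure d L β 0) k).re with hR
  have h1 : β * (4 * ε ^ 2 * (W * ((L : ℝ) ^ d * R))) =
      (2 * (L : ℝ) ^ d * ε * W) * (2 * β * ε * R) := by ring
  rw [h1] at hsum
  have hpos : 0 < 2 * (L : ℝ) ^ d * ε * W := by positivity
  have h2 : 2 * β * ε * R ≤ 1 := by
    by_contra hcon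
    push Not at hcon
    nlinarith
  show R ≤ 1 / (2 * β * ε)
  rw [le_div_iff₀ (by positivity)]
  linarith

end Literature.Probability.LatticeModels
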